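import Summits.CriticalPhenomena.CardyFormulaZ2.Theorems.CardyIKTransportIKLinearTransportWallDomination
import Summits.CriticalPhenomena.CardyFormulaZ2.Theorems.CardyIKTransportIKLinearTransportWallDominationHonThinRing

/-!
# `CardyIKTransport.IKLinearTransport` (stmt-CriticalPhenomena-5076), line `pinned-diagram-exchange`, lead c8 —
# WALL DOMINATION, first application: BLACK CIRCUITS THROUGH THE WALL ("thin rings") FOR EVERY COLUMN PATTERN

Support file (`--supports stmt-CriticalPhenomena-5076`, registered sub-goal `thinRingChain_all`).  The composition of the
landed `twoWallDomination` (`…WallDomination.lean`, the FKG substitute across a column) with the landed site-`𝕋` input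
`stub_honThinRingChain` (`…WallDominationHonThinRing.lean`: RSW + Harris + gluing on the all-honeycomb slab) through the
landed `thinRingChain_all_of` (`…WallDominationRingDefs.lean`).

RESULT: there is `c > 0` such that for EVERY `n ≥ 1`, on the cylinder slab `Fin (2n+1) × ℤ/8n` with middle (wall) column `n` and
EVERY face-type pattern `τ` (every column-mixed Izergin–Korepin / honeycomb pattern), with probability `≥ c` there are wall cells
`u, u'` with rows in `[2n, 3n)` and `v, v'` with rows in `[5n, 6n)` such that `u` is joined to `v` by a black path inside the right
half-slab, `u'` to `v'` inside the left half-slab, and `u' ⋯ u`, `v' ⋯ v` are chained through wall cells of their windows by black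
half-slab connections — a black closed curve through the wall, FKG-free.  (In the plane such a curve has winding number one around
every white wall cell strictly between the windows; the planar transfer is the subject of the lead's wave 3.)
-/

noncomputable section

namespace Summit.CriticalPhenomena.CardyFormulaZ2.Theorems.IKLinearTransport.PinnedDiagramExchange.WallDomination

open Summit.CriticalPhenomena.CardyFormulaZ2.Cruxes.IKMixedBoxCrossing.DefectClosureExploration

/-- **THIN RINGS THROUGH THE WALL FOR EVERY COLUMN PATTERN** (registered sub-goal `thinRingChain_all`): with the site-`𝕋`
constant `c > 0`, for every `n ≥ 1`, `L = 8n` and every face-type pattern `τ` on the slab of `n + n` face columns,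
`c ≤ cylProb (n + n) L τ (thinRingChain n n (winA n L) (winB n L))`. -/
theorem thinRingChain_all : ∃ c : ℝ, 0 < c ∧ ∀ n : ℕ, 1 ≤ n → ∀ (L : ℕ) [NeZero L], L = 8 * n → ∀ τ : Fin (n + n) → Bool,
    c ≤ cylProb (n + n) L τ (thinRingChain n n (winA n L) (winB n L)) :=
  thinRingChain_all_of twoWallDomination stub_honThinRingChain

end Summit.CriticalPhenomena.CardyFormulaZ2.Theorems.IKLinearTransport.PinnedDiagramExchange.WallDomination

end
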